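import Mathlib
import HarnessLib

/-!
# Washington period transfer — the ★-lemma `LevelSetInversion` PROVED: finite Fourier inversion on `ZMod b` turns «all norm-twisted sums
# `Σ_x ζ^{a·N(x)} G(x)` vanish» into «every norm-level-set sum `Σ_{N(x)=n} G(x)` vanishes» — idea card `Cruxes/SignedMuSeedAtTwoPlus/Ideas/
# washington-period-transfer.md` (k1 g34), seed crux `SignedMuSeedAtTwoPlus` stmt-BirchSwinnertonDyer-21438 (parent Kμ⁺ `SignedMuVanishingAtTwoPlus`
# stmt-BirchSwinnertonDyer-20689, route ResidualThetaTransportAtTwo)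

Cell `bsd-wall`, width seat `bsd-wall-rtt-p4-w2` g19 (`--supports`, closes nothing).  THEOREMS ONLY; BSD is not proved by this and nothing
arithmetic is asserted: character sums over `ZMod b` with values in a domain.

The card's sketch `Cruxes/SignedMuSeedAtTwoPlus/Lines/washington_period_transfer.lean` types two first statements: `PeriodTransfer` (proved there)
and `LevelSetInversion` (typed, NOT proved there):

  `∀ (R : Type) [CommRing R] [IsDomain R] (b : ℕ) [NeZero b], IsUnit (b : R) → ∀ ζ, IsPrimitiveRoot ζ b → ∀ (X : Type) [Fintype X]
   (N : X → ZMod b) (G : X → R), (∀ a : ZMod b, ∑ x, ζ ^ (a * N x).val * G x = 0) → ∀ n : ZMod b, ∑ x ∈ univ.filter (N · = n), G x = 0`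

(«the form in which ¬(U′) becomes a statement about sums of `G_ε⁺` over norm-hyperbolas / anticyclotomic-torus orbits in `Ẽ[b]`»; `b` odd, so a unit
in characteristic `2`).  THIS FILE proves it, with the universes generalised (`levelSet_sum_eq_zero`; the card's `Prop` is the `Type 0` instance, so
`fun R _ _ b _ hb ζ hζ X _ N G hG n => levelSet_sum_eq_zero hb hζ N G hG n` inhabits `WashingtonPeriodTransfer.LevelSetInversion`).  Proof: with the
additive character `ψ = AddChar.zmodChar b (ζ^b = 1)` (`ψ a = ζ^{a.val}`, primitive for `ζ` a primitive `b`-th root — Mathlib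
`AddChar.zmodChar_primitive_of_primitive_root`), `Σ_a ψ(−an)·Σ_x ψ(a N(x)) G(x) = Σ_x G(x) Σ_a ψ(a(N(x) − n)) = b · Σ_{N(x)=n} G(x)` (orthogonality,
Mathlib `AddChar.sum_mulShift`), and `b` is a unit.

* `sum_twist_eq` — `Σ_a ψ(a(−n)) Σ_x ψ(a N x) G x = b · Σ_{N x = n} G x`;  **`levelSet_sum_eq_zero`** — the ★-lemma.

[folklore]
-/

set_option autoImplicit false
-- the Theorems namespace of this sub repeats the summit name by design (D-0017 nested layout)
set_option linter.dupNamespace false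

open Finset

namespace Summit.BirchSwinnertonDyer.BirchSwinnertonDyer.Theorems.SignedMuAtTwo.WashingtonPeriodTransfer

universe u v

variable {R : Type u} [CommRing R] [IsDomain R] {b : ℕ} [NeZero b] {X : Type v} [Fintype X]

/-- Orthogonality bookkeeping: for the additive character `ψ` of `ZMod b` attached to a primitive `b`-th root of unity,
`Σ_a ψ(a·(−n)) · (Σ_x ψ(a·N x) G x) = b · Σ_{N x = n} G x`. [folklore] -/
theorem sum_twist_eq {ζ : R} (hζ : IsPrimitiveRoot ζ b) (N : X → ZMod b) (G : X → R) (n : ZMod b) :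
    ∑ a : ZMod b, AddChar.zmodChar b (((IsPrimitiveRoot.iff_def ζ b).mp hζ).left) (a * -n) *
        ∑ x, AddChar.zmodChar b (((IsPrimitiveRoot.iff_def ζ b).mp hζ).left) (a * N x) * G x =
      (b : R) * ∑ x ∈ univ.filter (fun x => N x = n), G x := by
  classical
  set ψ := AddChar.zmodChar b (((IsPrimitiveRoot.iff_def ζ b).mp hζ).left) with hψ
  have hprim : ψ.IsPrimitive := AddChar.zmodChar_primitive_of_primitive_root b hζ
  calc ∑ a : ZMod b, ψ (a * -n) * ∑ x, ψ (a * N x) * G x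
      = ∑ a : ZMod b, ∑ x, ψ (a * (N x - n)) * G x := by
        refine sum_congr rfl fun a _ => ?_
        rw [mul_sum]
        refine sum_congr rfl fun x _ => ?_
        rw [← mul_assoc, ← AddChar.map_add_eq_mul, mul_sub, sub_eq_add_neg, add_comm, mul_neg]
    _ = ∑ x, G x * ∑ a : ZMod b, ψ (a * (N x - n)) := by
        rw [sum_comm]
        refine sum_congr rfl fun x _ => ?_
        rw [mul_sum]
        refine sum_congr rfl fun a _ => ?_
        rw [mul_comm]
    _ = ∑ x, G x * ((if N x - n = 0 then Fintype.card (ZMod b) else 0 : ℕ) : R) := by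
        refine sum_congr rfl fun x _ => ?_
        rw [AddChar.sum_mulShift (N x - n) hprim]
    _ = (b : R) * ∑ x ∈ univ.filter (fun x => N x = n), G x := by
        rw [sum_filter, mul_sum]
        refine sum_congr rfl fun x _ => ?_
        by_cases h : N x = n
        · simp [h, ZMod.card, mul_comm]
        · simp [h, sub_eq_zero]

/-- **The ★-lemma `LevelSetInversion` of the card `washington-period-transfer`, PROVED**: if every additively twisted sum
`Σ_x ζ^{(a·N x).val} G x` over a finite set vanishes (`a : ZMod b`), then every level-set sum `Σ_{N x = n} G x` vanishes — for `R` a domain in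
which `b` is a unit and `ζ` a primitive `b`-th root of unity. [folklore] -/
theorem levelSet_sum_eq_zero (hb : IsUnit (b : R)) {ζ : R} (hζ : IsPrimitiveRoot ζ b) (N : X → ZMod b) (G : X → R)
    (hG : ∀ a : ZMod b, ∑ x, ζ ^ (a * N x).val * G x = 0) (n : ZMod b) :
    ∑ x ∈ univ.filter (fun x => N x = n), G x = 0 := by
  have key := sum_twist_eq hζ N G n
  have hzero : ∀ a : ZMod b,
      ∑ x, AddChar.zmodChar b (((IsPrimitiveRoot.iff_def ζ b).mp hζ).left) (a * N x) * G x = 0 := fun a => by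
    simp only [AddChar.zmodChar_apply]
    exact hG a
  simp only [hzero, mul_zero, sum_const_zero] at key
  exact (hb.mul_right_eq_zero).1 key.symm

end Summit.BirchSwinnertonDyer.BirchSwinnertonDyer.Theorems.SignedMuAtTwo.WashingtonPeriodTransfer
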